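import Literature.Analysis.FluidPDE.FluidComputer.ThresholdDrainConversion
import Literature.Analysis.FluidPDE.FluidComputer.ThresholdClockSide
import Literature.Analysis.FluidPDE.FluidComputer.ThresholdIgnition
import HarnessLib

/-!
# Fluid computer blueprint — threshold gate, stage 3: IGNITION + TRANSFER load the output (REACH)

HONEST FRAMING: low prior, high value-of-information experiment on Tao's machine paradigm; NOT a
claim that NS blows up. Finite-dimensional ODE theory about the explicit five-mode threshold circuit
`thresholdCircuit` (`ThresholdGate.lean`); nothing is asserted about any fluid equation.

## What

The REACH half of the threshold gate's last stage, in curve form and for EVERY `δ`-admissible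
forcing: a curve `x` on `[0, T₃]` which is continuous, stays in the energy ball `{|Xᵢ| < R_b}` on
`[0, T₃)` and has a `δ`-admissible right derivative there (the three binders the reach interface
`ReachCertificate.cert` hands to a stage), which starts from ignition data (loaded `a ≥ a₁`,
un-ignited `0 ≤ c < C`, clock past the band — the hypotheses of `exists_first_ignition` with horizon
`T_ig < T₃`) and whose output is preloaded by the forcing budget (`ã(0) ≥ δT₃`, so that `ã ≥ 0`
throughout), LOADS ITS OUTPUT: `ã(t)² ≥ E_out` at some `t ≤ T₃`
(`exists_output_loaded`). The chain: first ignition `c(s) = C` at `s ≤ T_ig` with the box data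
(`ThresholdIgnition.lean`) ⟶ on the shifted window `u ↦ x(s + u)` of length `T_tr = T₃ - T_ig`, with
the angle clock `Θ = ∫ r c` (a primitive, `ODE/LinearComparison.lean`), the CLOCK SIDE keeps
`c ∈ [c₀, Cm]`, `b ∈ [0, B]` until the angle `Θt = r·Cm·T_A + Θ_d` is turned, at `t₁ ≤ T_tr`
(`ThresholdClockSide.lean`) ⟶ the DRAIN CONVERSION on `[0, t₁]` bounds `ã(t₁)²` from below
(`ThresholdDrainConversion.lean`: build-up to the band level `L` within `T_A`, then overdamped decay
of the carrier–conduit pair over the extra angle `Θ_d`, then energy bookkeeping).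

## The hypotheses, and which are design inequalities

Besides signs and the binders: the ignition block is verbatim that of `exists_first_ignition`
(`R := R_b`, `T := T_ig`); `hpre` is the output preload; `hfloor`, `hlong`, `hCm`, `hLfloor`,
`hLceil`, `hceil` are inequalities among the design constants
`(c₀, Cm, B, T_A, Θ_d, β, λ, u₀, L, E_out)`; and `hign` asks the remaining six inequalities of the
clock side and of the conversion (clock ceiling/floor, rate inequality, pair-energy floor, build-up
reach, output level) AT EVERY POSSIBLE IGNITION STATE — every `Y` of the ignition boxes
`boxTube … (x 0) t`, `t ≤ T_ig`, with `Y₂ = C` and `|Yᵢ| ≤ R_b` — which is where a designer reads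
off the numbers (the boxes bound `Y₁` two-sidedly, `Y₀ ≥ a₁`, the output pair and the energy drift).
All of them are polynomial / exponential closed forms in the constants; none is checked here (the
cell's ASSEMBLY.md §2k lists them against the calibration run kit j049182).
[cite: Tao2016AveragedNS, §5.5 Thm 5.3 (5.5) (the three windows of the quadratic circuit)]
-/

noncomputable section

open Set Filter Topology
open scoped NNReal

namespace Literature.Analysis.FluidPDE.FluidComputer

open Literature.Analysis.FluidPDE.Tao2016AveragedNS Literature.Analysis.ODE

variable {ε σ ν μ r κ δ a₀ : ℝ}

/-- **IGNITION + TRANSFER LOAD THE OUTPUT** (stage 3 of the threshold gate, REACH in curve form; see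
the module docstring for the chain and the status of each hypothesis). [folklore] -/
theorem exists_output_loaded {x : ℝ → Fin 5 → ℝ}
    {T₃ Tig a₁ C Rb c₀ Cm B Θd TA β lam u₀ L Eout : ℝ}
    (hε : 0 ≤ ε) (hσ : 0 ≤ σ) (hν : 0 ≤ ν) (hμ : 0 ≤ μ) (hr : 0 < r) (hκ : 0 < κ) (hδ : 0 ≤ δ)
    (hRb : 0 ≤ Rb) (ha₀ : 0 ≤ a₀) (ha₁ : a₀ < a₁) (hTig : 0 < Tig) (hT₃ : Tig < T₃)
    (hc₀ : 0 < c₀) (hCm0 : 0 ≤ Cm) (hB0 : 0 ≤ B) (hΘd : 0 < Θd) (hTA : 0 ≤ TA) (hβ0 : 0 < β)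
    (hβ1 : β ≤ 1) (hlam0 : 0 ≤ lam) (hlam : lam ≤ β / 4) (hu₀ : 0 ≤ u₀)
    -- the curve (binders of `ReachCertificate.cert` over the energy ball `modeBall Rb`)
    (hcont : ContinuousOn x (Icc 0 T₃)) (hU : ∀ t ∈ Ico 0 T₃, ∀ i, |x t i| < Rb)
    (hder : ∀ t ∈ Ico 0 T₃, ∃ V, HasDerivWithinAt x V (Ici t) t ∧
      ‖V - thresholdCircuit ε σ ν μ r κ (x t)‖ ≤ δ)
    -- ignition data (hypotheses of `exists_first_ignition`, horizon `Tig`, ball `Rb`)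
    (ha : a₁ ≤ x 0 0) (hc0 : 0 ≤ x 0 2) (hc0C : x 0 2 < C) (hs : δ < σ * a₀ ^ 2)
    (hER : energy (x 0) + 10 * (δ * Rb) * Tig < Rb ^ 2)
    (hEa : a₁ ^ 2 + 10 * (δ * Rb) * Tig +
        max |x 0 1 - (ν * C ^ 2 + δ) * Tig| |x 0 1 + (ε * Rb ^ 2 + δ) * Tig| ^ 2 + C ^ 2 +
        (Real.sqrt (x 0 3 ^ 2 + x 0 4 ^ 2) + (r * Rb * C + 2 * δ) * Tig) ^ 2 < energy (x 0))
    (hbal : ν * C ^ 2 + δ ≤ ε * a₀ ^ 2) (hρ₁ : 0 < ν * x 0 1 - μ * Rb)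
    (hτ : Real.log (1 + (ν * x 0 1 - μ * Rb) * C / (σ * a₀ ^ 2 - δ)) / (ν * x 0 1 - μ * Rb) < Tig)
    -- output preload (keeps `ã ≥ 0` under the forcing)
    (hpre : δ * T₃ ≤ x 0 4)
    -- design inequalities among the constants (transfer window of length `T₃ - Tig`)
    (hfloor : c₀ + δ * (T₃ - Tig) < C) (hlong : r * Cm * TA + Θd ≤ r * c₀ * (T₃ - Tig))
    (hCm : C + ((ν * B + μ * Rb) / r + (σ * Rb ^ 2 + δ) / (r * c₀)) * (r * Cm * TA + Θd) < Cm)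
    (hLfloor : β * (r * Cm) + κ * δ * (T₃ - Tig) ≤ L) (hLceil : L ≤ r * c₀)
    (hceil : β * (κ * Rb) ≤ 2 * (r * c₀))
    -- design inequalities at every possible ignition state
    (hign : ∀ t ∈ Icc 0 Tig, ∀ Y ∈ boxTube ε ν r δ a₁ Rb C (x 0) t, Y 2 = C →
      (∀ i, |Y i| ≤ Rb) →
      Y 1 + (ε * Rb ^ 2 + δ) * (T₃ - Tig) ≤ B ∧
      0 ≤ Y 1 - ν * Cm / r * (r * Cm * TA + Θd) - δ * (T₃ - Tig) ∧
      μ ^ 2 * (Y 0 ^ 2 + Y 3 ^ 2 + 2 * μ * Rb * Cm / r * (r * Cm * TA + Θd) +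
          4 * (Rb * δ) * (T₃ - Tig)) ≤
        ν ^ 2 * (Y 1 - ν * Cm / r * (r * Cm * TA + Θd) - δ * (T₃ - Tig)) ^ 2 ∧
      u₀ ≤ energy Y - 10 * (δ * Rb) * (T₃ - Tig) - B ^ 2 - Cm ^ 2 - (L / κ) ^ 2 ∧
      L ≤ κ * (Y 4 - κ / (r * Cm) * Rb ^ 2 +
        κ / (r * Cm) / 2 * ((1 - 1 / 2) * u₀) * (r * c₀ * TA) -
        (κ / (r * Cm) * Rb * (ε * Rb ^ 2 + σ * Rb * Cm + μ * Cm ^ 2 + δ) + δ) * TA) ∧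
      Eout ≤ energy Y - 10 * (δ * Rb) * (T₃ - Tig) - B ^ 2 - Cm ^ 2 -
        Real.exp (-lam * Θd) * ((1 + β / 2) * (energy Y + 10 * (δ * Rb) * (T₃ - Tig)) +
          8 * Rb * (ε * Rb ^ 2 + σ * Rb * Cm + μ * Cm ^ 2 + δ) *
            Real.exp (lam * (r * Cm * TA + Θd)) * (T₃ - Tig)) / (1 - β / 2)) :
    ∃ t ∈ Icc 0 T₃, Eout ≤ x t 4 ^ 2 := by
  have hT₃0 : 0 < T₃ := hTig.trans hT₃
  have hC : 0 < C := lt_of_le_of_lt hc0 hc0C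
  set Ttr := T₃ - Tig with hTtr_def
  have hTtr : 0 < Ttr := by rw [hTtr_def]; linarith
  set Θt := r * Cm * TA + Θd with hΘt_def
  have hΘt : 0 < Θt := by
    have : 0 ≤ r * Cm * TA := by positivity
    rw [hΘt_def]; linarith
  -- closed mode bounds on `[0, T₃]`
  have hRall : ∀ t ∈ Icc 0 T₃, ∀ i, |x t i| ≤ Rb := by
    intro t ht i
    rcases eq_or_lt_of_le ht.1 with h0 | hpos
    · rw [← h0]; exact (hU 0 ⟨le_rfl, hT₃0⟩ i).le
    · exact le_const_of_forall_Ico (g := fun s => |x s i|)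
        ((continuous_apply i).comp_continuousOn hcont).abs ⟨hpos, ht.2⟩
        (fun s hs' => (hU s ⟨hs'.1, lt_of_lt_of_le hs'.2 ht.2⟩ i).le)
  -- the forced window on `[0, T₃]`; the preload keeps `ã ≥ 0`
  have hX : IsForcedWindow ε σ ν μ r κ δ T₃ x := ⟨hcont, hder⟩
  have hout : ∀ t ∈ Icc 0 T₃, 0 ≤ x t 4 := by
    intro t ht
    have h1 := hX.output_ge_affine hκ.le t ht
    have h2 : δ * t ≤ δ * T₃ := mul_le_mul_of_nonneg_left ht.2 hδ
    linarith
  -- FIRST IGNITION by time `Tig`, with the box data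
  obtain ⟨s, hsI, hCs, hun, hbox⟩ := exists_first_ignition (κ := κ) (a₀ := a₀) (R := Rb)
    hε hσ hν hμ hr.le hδ hRb ha₀ ha₁ hTig (hcont.mono (Icc_subset_Icc_right hT₃.le))
    (fun t ht => hU t ⟨ht.1, ht.2.trans hT₃⟩) (fun t ht => hder t ⟨ht.1, ht.2.trans hT₃⟩)
    ha hc0 hc0C hs hER hEa hbal hρ₁ hτ
  have hsT₃ : s ≤ T₃ := hsI.2.trans hT₃.le
  have hcs : x s 2 = C := by
    refine le_antisymm ?_ hCs
    exact le_const_of_forall_Ico (g := fun t => x t 2)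
      ((continuous_apply 2).comp_continuousOn (hcont.mono (Icc_subset_Icc_right hsT₃)))
      ⟨hsI.1, le_rfl⟩ (fun t ht => (hun t ht).le)
  -- the design data at the ignition state `x s`
  obtain ⟨hBY, hblY, hrateY, hu₀Y, hreachY, hEoutY⟩ := hign s ⟨hsI.1.le, hsI.2⟩ (x s)
    (hbox s ⟨hsI.1.le, le_rfl⟩) hcs (hRall s ⟨hsI.1.le, hsT₃⟩)
  -- the shifted window `u ↦ x (s + u)` on `[0, Ttr]`
  have hY : IsForcedWindow ε σ ν μ r κ δ Ttr (fun u => x (s + u)) :=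
    (hX.shift ⟨hsI.1.le, hsT₃⟩).mono (by rw [hTtr_def]; linarith [hsI.2])
  have hRy : ∀ t ∈ Icc 0 Ttr, ∀ i, |x (s + t) i| ≤ Rb := fun t ht i =>
    hRall (s + t) ⟨by linarith [hsI.1, ht.1], by rw [hTtr_def] at ht; linarith [ht.2, hsI.2]⟩ i
  have houty : ∀ t ∈ Ico 0 Ttr, 0 ≤ x (s + t) 4 := fun t ht =>
    hout (s + t) ⟨by linarith [hsI.1, ht.1], by rw [hTtr_def] at ht; linarith [ht.2, hsI.2]⟩
  -- the angle clock `Θ = ∫ r c` of the shifted window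
  have hcy : ContinuousOn (fun u => r * x (s + u) 2) (Icc 0 Ttr) :=
    continuousOn_const.mul ((continuous_apply 2).comp_continuousOn hY.continuousOn)
  set Θ : ℝ → ℝ := fun u => ∫ v in (0 : ℝ)..u,
    IccExtend hTtr.le ((Icc 0 Ttr).restrict fun u => r * x (s + u) 2) v with hΘ_def
  have hΘ' : ∀ t ∈ Ico 0 Ttr, HasDerivWithinAt Θ (r * (fun u => x (s + u)) t 2) (Ici t) t :=
    fun t ht => hasDerivWithinAt_primitive hTtr.le hcy ht
  have hΘc : ContinuousOn Θ (Icc 0 Ttr) :=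
    (intervalIntegral.continuous_primitive
      (continuous_IccExtend_restrict hTtr.le hcy).intervalIntegrable 0).continuousOn
  have hΘ0 : Θ 0 = 0 := intervalIntegral.integral_same
  -- THE CLOCK SIDE: the band `c ∈ [c₀, Cm]`, `b ∈ [0, B]` until the angle `Θt` is turned
  have hcC : (fun u => x (s + u)) 0 2 = C := by
    show x (s + 0) 2 = C
    rw [add_zero]; exact hcs
  have hB' : (fun u => x (s + u)) 0 1 + (ε * Rb ^ 2 + δ) * Ttr ≤ B := by
    show x (s + 0) 1 + (ε * Rb ^ 2 + δ) * Ttr ≤ B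
    rw [add_zero]; exact hBY
  have hbl' : 0 ≤ (fun u => x (s + u)) 0 1 - ν * Cm / r * Θt - δ * Ttr := by
    show 0 ≤ x (s + 0) 1 - ν * Cm / r * Θt - δ * Ttr
    rw [add_zero]; exact hblY
  have hrate' : μ ^ 2 * ((fun u => x (s + u)) 0 0 ^ 2 + (fun u => x (s + u)) 0 3 ^ 2 +
      2 * μ * Rb * Cm / r * Θt + 4 * (Rb * δ) * Ttr) ≤
      ν ^ 2 * ((fun u => x (s + u)) 0 1 - ν * Cm / r * Θt - δ * Ttr) ^ 2 := by
    show μ ^ 2 * (x (s + 0) 0 ^ 2 + x (s + 0) 3 ^ 2 + 2 * μ * Rb * Cm / r * Θt +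
      4 * (Rb * δ) * Ttr) ≤ ν ^ 2 * (x (s + 0) 1 - ν * Cm / r * Θt - δ * Ttr) ^ 2
    rw [add_zero]; exact hrateY
  obtain ⟨t₁, ht₁, hΘt₁, hwin⟩ := hY.clock_side hε hσ hν hμ hr hκ.le hδ hRb hB0 hTtr.le hc₀ hΘt
    hΘ0 hΘc hΘ' hRy houty hcC hfloor hlong hB' hCm hbl' hrate'
  -- consequences on `[0, t₁]`
  have hCm_pos : 0 < Cm := by
    have h1 := (hwin 0 ⟨le_rfl, ht₁.1.le⟩).1
    have h2 : c₀ ≤ x (s + 0) 2 := h1.1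
    have h3 : x (s + 0) 2 ≤ Cm := h1.2
    linarith
  have hW₁ := hY.mono ht₁.2
  have hΘc₁ : ContinuousOn Θ (Icc 0 t₁) := hΘc.mono (Icc_subset_Icc_right ht₁.2)
  have hΘ'₁ : ∀ t ∈ Ico 0 t₁, HasDerivWithinAt Θ (r * (fun u => x (s + u)) t 2) (Ici t) t :=
    fun t ht => hΘ' t ⟨ht.1, lt_of_lt_of_le ht.2 ht₁.2⟩
  have hTA₁ : TA ≤ t₁ := by
    have h1 := IsForcedWindow.angle_le_mul (x := fun u => x (s + u)) hr.le hΘ0 hΘc₁ hΘ'₁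
      (fun t ht => (hwin t (Ico_subset_Icc_self ht)).1.2) t₁ ⟨ht₁.1.le, le_rfl⟩
    rw [hΘt₁, hΘt_def] at h1
    have hrCm : 0 < r * Cm := mul_pos hr hCm_pos
    by_contra hlt
    rw [not_le] at hlt
    have := mul_lt_mul_of_pos_left hlt hrCm
    linarith
  -- THE DRAIN CONVERSION on `[0, t₁]` (budget horizon `Ttr`, angle ceiling `Θt`)
  have hu₀E' : u₀ ≤ energy ((fun u => x (s + u)) 0) - 10 * (δ * Rb) * Ttr - B ^ 2 - Cm ^ 2 -
      (L / κ) ^ 2 := by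
    show u₀ ≤ energy (x (s + 0)) - 10 * (δ * Rb) * Ttr - B ^ 2 - Cm ^ 2 - (L / κ) ^ 2
    rw [add_zero]; exact hu₀Y
  have hreach' : L ≤ κ * ((fun u => x (s + u)) 0 4 - κ / (r * Cm) * Rb ^ 2 +
      κ / (r * Cm) / 2 * ((1 - 1 / 2) * u₀) * (r * c₀ * TA) -
      (κ / (r * Cm) * Rb * (ε * Rb ^ 2 + σ * Rb * Cm + μ * Cm ^ 2 + δ) + δ) * TA) := by
    show L ≤ κ * (x (s + 0) 4 - κ / (r * Cm) * Rb ^ 2 +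
      κ / (r * Cm) / 2 * ((1 - 1 / 2) * u₀) * (r * c₀ * TA) -
      (κ / (r * Cm) * Rb * (ε * Rb ^ 2 + σ * Rb * Cm + μ * Cm ^ 2 + δ) + δ) * TA)
    rw [add_zero]; exact hreachY
  have hconv := hW₁.output_sq_ge_of_angle hε hσ hμ hr hκ hδ (ΘM := Θt) (Θd := Θd) (T := Ttr)
    hRb hCm_pos hc₀ hβ0 hβ1 hlam0 hlam hu₀ hΘd ht₁.2 hΘ0 hΘc₁ hΘ'₁
    (fun t ht => (hwin t ht).2.1) (fun t ht => (hwin t ht).1)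
    (fun t ht i => hRy t ⟨ht.1, ht.2.trans ht₁.2⟩ i)
    (fun t ht => abs_le.2 ⟨by linarith [(hwin t ht).2.2.1, hB0], (hwin t ht).2.2.2⟩)
    (fun t ht => houty t ⟨ht.1, lt_of_lt_of_le ht.2 ht₁.2⟩)
    hLfloor hLceil hceil hu₀E' ⟨hTA, hTA₁⟩ hreach' t₁ ⟨ht₁.1.le, le_rfl⟩ (by rw [hΘt₁])
  have hEout' : Eout ≤ energy ((fun u => x (s + u)) 0) - 10 * (δ * Rb) * Ttr - B ^ 2 - Cm ^ 2 -
      Real.exp (-lam * Θd) * ((1 + β / 2) * (energy ((fun u => x (s + u)) 0) +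
        10 * (δ * Rb) * Ttr) + 8 * Rb * (ε * Rb ^ 2 + σ * Rb * Cm + μ * Cm ^ 2 + δ) *
          Real.exp (lam * Θt) * Ttr) / (1 - β / 2) := by
    show Eout ≤ energy (x (s + 0)) - 10 * (δ * Rb) * Ttr - B ^ 2 - Cm ^ 2 -
      Real.exp (-lam * Θd) * ((1 + β / 2) * (energy (x (s + 0)) + 10 * (δ * Rb) * Ttr) +
        8 * Rb * (ε * Rb ^ 2 + σ * Rb * Cm + μ * Cm ^ 2 + δ) * Real.exp (lam * Θt) * Ttr) /
        (1 - β / 2)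
    rw [add_zero]; exact hEoutY
  refine ⟨s + t₁, ⟨by linarith [hsI.1, ht₁.1], ?_⟩, hEout'.trans hconv⟩
  have := ht₁.2
  rw [hTtr_def] at this
  linarith [hsI.2]

end Literature.Analysis.FluidPDE.FluidComputer

end
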